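/-
Copyright: the b2b-balaban T⁴-continuum CRUX team, row NE7b leaf lineage `t4-ne7b-formalise-leaf-05` (gen 157). Project licence.
-/
import Mathlib.Analysis.InnerProductSpace.PiL2
import Mathlib.Algebra.Order.Chebyshev
import Literature.Topology.FourManifolds.ConeDifferentialLink

/-!
# A QUADRATIC PARTITION OF UNITY FROM A LINEAR ONE: `h_s = φ_s ∕ (Σ_r φ_r²)^{1∕2}` has `Σ_s h_s² = 1`, the SAME support (multiplicity letters transfer
# verbatim) and Lipschitz letters at most `2√μ₀` times those of `φ` in `ℓ²` over the cubes — the three (h2)-skeleton letters `hpart` ∕ (mult) ∕ (Lip) of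
# `…AdmissibleFloorIMS`, `…IMSErrorLetters`, `…AdmissibleFloorSeminormIMS`, `…AdmissibleFloorSeminormTerms` from the elementary tent partition
# (row NE7b, node U5c; residual (R2′) family (2), letter (ℓ1); kernel lemmas)

Cell `pub-balaban`, sub-cell `t4`, spine estimate NE7b (`T4WeightBudget.RelWeightBound`; the cell's OWN estimate — NOT PRINTED in [Bałaban 1983–89],
NOT PROVED).  Crux-route work under `Spine/NE7b/`; NOTHING of Bałaban's is asserted; no `def`; zero `sorry`; no `T4Continuum/Support` leaf (FREEZE (0)).
Imports: Mathlib (`InnerProductSpace.PiL2` for `EuclideanSpace ℝ ι`, `Algebra.Order.Chebyshev` for `sq_sum_le_card_mul_sum_sq`) and the tree's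
`Literature.Topology.FourManifolds.ConeDifferentialLink` for the [folklore] `norm_inv_norm_smul_sub_inv_norm_smul_le` (`‖a∕‖a‖ − b∕‖b‖‖ ≤ 2‖a − b‖∕‖b‖`), reused
BY NAME rather than restated (cross-area import of a normed-space lemma only).

WHY.  Every (h2) file of this lineage displays the IMS partition through three letters: `hpart : Σ_s h_s(i)² = 1` (a QUADRATIC partition of unity), (mult) at
most `μ` cutoffs alive at a site ∕ a pair ∕ a term, (Lip) `|h_s(i) − h_s(j)| ≤ ℓ·dist(i,j)` (IEL) or `Σ_s (h_s(i) − h_s(j))² ≤ …` (what `B9SectEKernel.ims_lower`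
actually consumes) or `|h_s(c) − h_s(c_j)| ≤ λ` on a term (AFST).  Print's `{h_□}` ([B6] Sect. A; SectE-interface-proof Prop. 5.6: «`Σ_□ h_□² = 1`, `|∇h_□| ≤ c_h∕M`,
each bond in `≤ 2^d` supports») is obtained from the LINEAR tent partition `{φ_□}` (`φ ≥ 0`, `Σ_□ φ_□ = 1`, `≤ 2^d` alive, `|∇φ_□| ≤ 1∕M`) by the normalisation
`h_□ = φ_□∕(Σ_□′ φ_□′²)^{1∕2}`.  THIS FILE proves that the normalisation carries the three letters, with the constants: `hpart` exactly; (mult) with the same `μ₀`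
(same support); (Lip) in `ℓ²(cubes)`: `Σ_s (h_s(i) − h_s(j))² ≤ 4μ₀·Σ_s (φ_s(i) − φ_s(j))²`, and pointwise `|h_s(i) − h_s(j)| ≤ 2√μ₀·(Σ_r (φ_r(i) − φ_r(j))²)^{1∕2}`.
So after it the partition's letters display ONLY through the tent partition's (elementary lattice geometry, leaf-02's currency).

WHAT IS PROVED ([folklore]; `ι` = cubes (finite), `m` = sites∕bonds (any type); `φ : ι → m → ℝ`; the normalised family is written out as
`fun s i => φ s i ∕ √(Σ_r φ r i ^ 2)` — no `def`):
* §1 `one_le_card_mul_sum_sq` (`φ ≥ 0`, `Σ_s φ_s(i) = 1`, `#{s : φ_s(i) ≠ 0} ≤ μ₀` ⊢ `1 ≤ μ₀·Σ_s φ_s(i)²`, Cauchy–Schwarz on the alive set), `sum_sq_pos`.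
* §2 **`sum_sq_normalise`** (`Σ_s h_s(i)² = 1` — the `hpart` letter VERBATIM), `normalise_eq_zero_iff` (`h_s(i) = 0 ↔ φ_s(i) = 0`), `normalise_nonneg`,
  **`card_alive_normalise`** ∕ **`card_alive_pair_normalise`** (the (mult) letters of IEL transfer with the same count).
* §3 `norm_toLp_eq_sqrt` (`‖(φ_·(i))‖₂ = √(Σ_s φ_s(i)²)`), **`sum_sq_normalise_sub_le`** (`Σ_s (h_s(i) − h_s(j))² ≤ 4μ₀·Σ_s (φ_s(i) − φ_s(j))²`),
  **`abs_normalise_sub_le`** (`|h_s(i) − h_s(j)| ≤ 2√μ₀·√(Σ_r (φ_r(i) − φ_r(j))²)`).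
* §4 toy: two cubes, `φ ≡ ½`: `Σ_s h_s² = 1` by §2 (`example`).

NOT HERE (honest): the tent partition on the two-scale torus itself and its letters by value (`μ₀ = 2^d`, `|φ_□(i) − φ_□(j)| ≤ dist(i,j)∕M`); which cubes ∕ scale
print's step uses; anything of Bałaban's.  BY-NAME EFFECT ON THE WALL: NONE.  NE7b NOT PRINTED ∕ NOT PROVED; spine PROVED 0∕9; rung (B)+1 on ONE finite T⁴ —
NOT infinite volume, NOT the mass gap, NOT Clay.
HONEST DEPENDENCY: continuum YM on T⁴ ⇐ BetaPertH ∧ nine spine estimates (0/9 proved); BetaPertH ⇐ (D1) ∧ (D4) ∧ CAP+tail; G-an2-4 gates asym, D1 and NE2/3/4.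
-/

set_option autoImplicit false

noncomputable section

open Finset WithLp

namespace Summit.QuantumFields.BalabanUV.T4Continuum.NE7b.QuadraticPartitionOfUnity

variable {ι m : Type*} [Fintype ι]

/-! ## §1 The square mass of a linear partition of unity with multiplicity `μ₀` is at least `1∕μ₀` -/

section Mass

/-- `1 ≤ μ₀·Σ_s φ_s(i)²` for a nonnegative partition of unity with at most `μ₀` cutoffs alive at `i` (Cauchy–Schwarz on the alive set:
`1 = (Σ_{alive} φ_s)² ≤ #alive·Σ φ_s²`). [folklore] -/
theorem one_le_card_mul_sum_sq (φ : ι → m → ℝ) (hsum : ∀ i, ∑ s, φ s i = 1)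
    {μ₀ : ℕ} (hmult : ∀ i, (Finset.univ.filter fun s => φ s i ≠ 0).card ≤ μ₀) (i : m) :
    1 ≤ (μ₀ : ℝ) * ∑ s, φ s i ^ 2 := by
  classical
  set A := Finset.univ.filter fun s => φ s i ≠ 0 with hA
  have hsumA : ∑ s ∈ A, φ s i = 1 := by
    rw [← hsum i, hA, Finset.sum_filter]
    refine Finset.sum_congr rfl fun s _ => ?_
    by_cases h : φ s i ≠ 0
    · rw [if_pos h]
    · rw [if_neg h]; exact (not_not.mp h).symm
  have hsqA : ∑ s ∈ A, φ s i ^ 2 ≤ ∑ s, φ s i ^ 2 :=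
    Finset.sum_le_sum_of_subset_of_nonneg (Finset.filter_subset _ _) fun s _ _ => sq_nonneg _
  have hcs := sq_sum_le_card_mul_sum_sq (s := A) (f := fun s => φ s i)
  rw [hsumA, one_pow] at hcs
  have hcard : (A.card : ℝ) ≤ μ₀ := by exact_mod_cast hmult i
  have hS : 0 ≤ ∑ s ∈ A, φ s i ^ 2 := Finset.sum_nonneg fun s _ => sq_nonneg _
  calc (1 : ℝ) ≤ A.card * ∑ s ∈ A, φ s i ^ 2 := hcs
    _ ≤ μ₀ * ∑ s ∈ A, φ s i ^ 2 := mul_le_mul_of_nonneg_right hcard hS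
    _ ≤ μ₀ * ∑ s, φ s i ^ 2 := mul_le_mul_of_nonneg_left hsqA (Nat.cast_nonneg _)

/-- … hence `0 < Σ_s φ_s(i)²`. [folklore] -/
theorem sum_sq_pos (φ : ι → m → ℝ) (hsum : ∀ i, ∑ s, φ s i = 1)
    {μ₀ : ℕ} (hmult : ∀ i, (Finset.univ.filter fun s => φ s i ≠ 0).card ≤ μ₀) (i : m) :
    0 < ∑ s, φ s i ^ 2 := by
  have h := one_le_card_mul_sum_sq φ hsum hmult i
  have hS : 0 ≤ ∑ s, φ s i ^ 2 := Finset.sum_nonneg fun s _ => sq_nonneg _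
  rcases hS.lt_or_eq with hlt | heq
  · exact hlt
  · rw [← heq, mul_zero] at h; norm_num at h

end Mass

/-! ## §2 The normalised family: `Σ_s h_s² = 1`, same support -/

section Normalise

/-- **`Σ_s h_s(i)² = 1`** for `h_s(i) = φ_s(i)∕√(Σ_r φ_r(i)²)` — the `hpart` letter of the (h2) skeletons VERBATIM. [folklore] -/
theorem sum_sq_normalise (φ : ι → m → ℝ) (hsum : ∀ i, ∑ s, φ s i = 1)
    {μ₀ : ℕ} (hmult : ∀ i, (Finset.univ.filter fun s => φ s i ≠ 0).card ≤ μ₀) (i : m) :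
    ∑ s, (φ s i / Real.sqrt (∑ r, φ r i ^ 2)) ^ 2 = 1 := by
  have hS := sum_sq_pos φ hsum hmult i
  simp_rw [div_pow, Real.sq_sqrt hS.le]
  rw [← Finset.sum_div, div_self hS.ne']

/-- Same support: `h_s(i) = 0 ↔ φ_s(i) = 0`. [folklore] -/
theorem normalise_eq_zero_iff (φ : ι → m → ℝ) (hsum : ∀ i, ∑ s, φ s i = 1)
    {μ₀ : ℕ} (hmult : ∀ i, (Finset.univ.filter fun s => φ s i ≠ 0).card ≤ μ₀) (s : ι) (i : m) :
    φ s i / Real.sqrt (∑ r, φ r i ^ 2) = 0 ↔ φ s i = 0 := by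
  have hS := Real.sqrt_pos.mpr (sum_sq_pos φ hsum hmult i)
  rw [div_eq_zero_iff, or_iff_left hS.ne']

omit [Fintype ι] in
/-- `h_s(i) ≥ 0` when `φ_s(i) ≥ 0`. [folklore] -/
theorem normalise_nonneg (φ : ι → m → ℝ) (hφ : ∀ s i, 0 ≤ φ s i) (S : m → ℝ) (s : ι) (i : m) :
    0 ≤ φ s i / Real.sqrt (S i) :=
  div_nonneg (hφ s i) (Real.sqrt_nonneg _)

/-- **THE SITE MULTIPLICITY LETTER TRANSFERS**: `#{s : h_s(i) ≠ 0} = #{s : φ_s(i) ≠ 0}`. [folklore] -/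
theorem card_alive_normalise (φ : ι → m → ℝ) (hsum : ∀ i, ∑ s, φ s i = 1)
    {μ₀ : ℕ} (hmult : ∀ i, (Finset.univ.filter fun s => φ s i ≠ 0).card ≤ μ₀) (i : m) :
    (Finset.univ.filter fun s => φ s i / Real.sqrt (∑ r, φ r i ^ 2) ≠ 0).card
      = (Finset.univ.filter fun s => φ s i ≠ 0).card := by
  congr 1
  ext s
  simp only [Finset.mem_filter, Finset.mem_univ, true_and, ne_eq, normalise_eq_zero_iff φ hsum hmult]

/-- **THE PAIR MULTIPLICITY LETTER TRANSFERS** (the shape of `…IMSErrorLetters.sum_sq_diff_le`'s (mult)): `#{s : h_s(i) ≠ 0 ∨ h_s(j) ≠ 0} = #{s : φ_s(i) ≠ 0 ∨ φ_s(j) ≠ 0}`.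
[folklore] -/
theorem card_alive_pair_normalise (φ : ι → m → ℝ) (hsum : ∀ i, ∑ s, φ s i = 1)
    {μ₀ : ℕ} (hmult : ∀ i, (Finset.univ.filter fun s => φ s i ≠ 0).card ≤ μ₀) (i j : m) :
    (Finset.univ.filter fun s =>
        φ s i / Real.sqrt (∑ r, φ r i ^ 2) ≠ 0 ∨ φ s j / Real.sqrt (∑ r, φ r j ^ 2) ≠ 0).card
      = (Finset.univ.filter fun s => φ s i ≠ 0 ∨ φ s j ≠ 0).card := by
  congr 1
  ext s
  simp only [Finset.mem_filter, Finset.mem_univ, true_and, ne_eq, normalise_eq_zero_iff φ hsum hmult]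

end Normalise

/-! ## §3 Lipschitz letters transfer with the factor `2√μ₀` (in `ℓ²` over the cubes) -/

section Lipschitz

/-- `‖(φ_·(i))‖₂ = √(Σ_s φ_s(i)²)` for the column read as a vector of `EuclideanSpace ℝ ι`. [folklore] -/
theorem norm_toLp_eq_sqrt (φ : ι → m → ℝ) (i : m) :
    ‖(toLp 2 (fun s => φ s i) : EuclideanSpace ℝ ι)‖ = Real.sqrt (∑ s, φ s i ^ 2) := by
  rw [← Real.sqrt_sq (norm_nonneg _), EuclideanSpace.real_norm_sq_eq]

/-- **THE `ℓ²` LIPSCHITZ LETTER TRANSFERS**: `Σ_s (h_s(i) − h_s(j))² ≤ 4μ₀·Σ_s (φ_s(i) − φ_s(j))²` — `h(i) = φ(i)∕‖φ(i)‖₂` in `ℝ^ι`,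
`‖a∕‖a‖ − b∕‖b‖‖ ≤ 2‖a − b‖∕‖b‖` (`Literature.Topology.FourManifolds.norm_inv_norm_smul_sub_inv_norm_smul_le` BY NAME) and `‖φ(j)‖₂² ≥ 1∕μ₀` (§1). [folklore] -/
theorem sum_sq_normalise_sub_le (φ : ι → m → ℝ) (hsum : ∀ i, ∑ s, φ s i = 1)
    {μ₀ : ℕ} (hmult : ∀ i, (Finset.univ.filter fun s => φ s i ≠ 0).card ≤ μ₀) (i j : m) :
    ∑ s, (φ s i / Real.sqrt (∑ r, φ r i ^ 2) - φ s j / Real.sqrt (∑ r, φ r j ^ 2)) ^ 2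
      ≤ 4 * μ₀ * ∑ s, (φ s i - φ s j) ^ 2 := by
  set a : EuclideanSpace ℝ ι := toLp 2 (fun s => φ s i) with ha
  set b : EuclideanSpace ℝ ι := toLp 2 (fun s => φ s j) with hb
  have hSi := sum_sq_pos φ hsum hmult i
  have hSj := sum_sq_pos φ hsum hmult j
  have hna : ‖a‖ = Real.sqrt (∑ r, φ r i ^ 2) := norm_toLp_eq_sqrt φ i
  have hnb : ‖b‖ = Real.sqrt (∑ r, φ r j ^ 2) := norm_toLp_eq_sqrt φ j
  have ha0 : a ≠ 0 := by
    rw [← norm_pos_iff, hna]; exact Real.sqrt_pos.mpr hSi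
  have hb0 : b ≠ 0 := by
    rw [← norm_pos_iff, hnb]; exact Real.sqrt_pos.mpr hSj
  -- the left-hand side is `‖a∕‖a‖ − b∕‖b‖‖²`
  have hL : ∑ s, (φ s i / Real.sqrt (∑ r, φ r i ^ 2) - φ s j / Real.sqrt (∑ r, φ r j ^ 2)) ^ 2
      = ‖‖a‖⁻¹ • a - ‖b‖⁻¹ • b‖ ^ 2 := by
    rw [EuclideanSpace.real_norm_sq_eq]
    refine Finset.sum_congr rfl fun s _ => ?_
    rw [PiLp.sub_apply, PiLp.smul_apply, PiLp.smul_apply, ha, hb, PiLp.toLp_apply, PiLp.toLp_apply, ← ha, ← hb,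
      hna, hnb, smul_eq_mul, smul_eq_mul, div_eq_inv_mul, div_eq_inv_mul]
  -- the right-hand side contains `‖a − b‖²`
  have hR : ∑ s, (φ s i - φ s j) ^ 2 = ‖a - b‖ ^ 2 := by
    rw [EuclideanSpace.real_norm_sq_eq]
    refine Finset.sum_congr rfl fun s _ => ?_
    rw [PiLp.sub_apply, ha, hb, PiLp.toLp_apply, PiLp.toLp_apply]
  have hkey := Literature.Topology.FourManifolds.norm_inv_norm_smul_sub_inv_norm_smul_le ha0 hb0
  have hbsq : 1 ≤ (μ₀ : ℝ) * ‖b‖ ^ 2 := by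
    rw [hnb, Real.sq_sqrt hSj.le]; exact one_le_card_mul_sum_sq φ hsum hmult j
  have hbpos : 0 < ‖b‖ := norm_pos_iff.mpr hb0
  rw [hL, hR]
  have h1 : ‖‖a‖⁻¹ • a - ‖b‖⁻¹ • b‖ ^ 2 ≤ (2 * ‖a - b‖ / ‖b‖) ^ 2 :=
    pow_le_pow_left₀ (norm_nonneg _) hkey 2
  have h2 : (2 * ‖a - b‖ / ‖b‖) ^ 2 = 4 * ‖a - b‖ ^ 2 * (‖b‖ ^ 2)⁻¹ := by
    rw [div_pow, mul_pow, ← inv_pow]; ring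
  have h3 : (‖b‖ ^ 2)⁻¹ ≤ μ₀ := by
    rw [inv_le_iff_one_le_mul₀ (by positivity)]
    linarith [hbsq]
  calc ‖‖a‖⁻¹ • a - ‖b‖⁻¹ • b‖ ^ 2 ≤ 4 * ‖a - b‖ ^ 2 * (‖b‖ ^ 2)⁻¹ := h1.trans h2.le
    _ ≤ 4 * ‖a - b‖ ^ 2 * μ₀ := mul_le_mul_of_nonneg_left h3 (by positivity)
    _ = 4 * μ₀ * ‖a - b‖ ^ 2 := by ring

/-- **THE POINTWISE LIPSCHITZ LETTER** (the shape of AFST's (Lip) ∕ IEL's (Lip)): `|h_s(i) − h_s(j)| ≤ 2√μ₀·√(Σ_r (φ_r(i) − φ_r(j))²)` — one coordinate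
is at most the `ℓ²` norm. [folklore] -/
theorem abs_normalise_sub_le (φ : ι → m → ℝ) (hsum : ∀ i, ∑ s, φ s i = 1)
    {μ₀ : ℕ} (hmult : ∀ i, (Finset.univ.filter fun s => φ s i ≠ 0).card ≤ μ₀) (s : ι) (i j : m) :
    |φ s i / Real.sqrt (∑ r, φ r i ^ 2) - φ s j / Real.sqrt (∑ r, φ r j ^ 2)|
      ≤ 2 * Real.sqrt μ₀ * Real.sqrt (∑ r, (φ r i - φ r j) ^ 2) := by
  have hsum2 := sum_sq_normalise_sub_le φ hsum hmult i j
  have hone : (φ s i / Real.sqrt (∑ r, φ r i ^ 2) - φ s j / Real.sqrt (∑ r, φ r j ^ 2)) ^ 2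
      ≤ ∑ s', (φ s' i / Real.sqrt (∑ r, φ r i ^ 2) - φ s' j / Real.sqrt (∑ r, φ r j ^ 2)) ^ 2 :=
    Finset.single_le_sum (f := fun s' => (φ s' i / Real.sqrt (∑ r, φ r i ^ 2) - φ s' j / Real.sqrt (∑ r, φ r j ^ 2)) ^ 2)
      (fun s' _ => sq_nonneg _) (Finset.mem_univ s)
  have hsq : (φ s i / Real.sqrt (∑ r, φ r i ^ 2) - φ s j / Real.sqrt (∑ r, φ r j ^ 2)) ^ 2
      ≤ (2 * Real.sqrt μ₀ * Real.sqrt (∑ r, (φ r i - φ r j) ^ 2)) ^ 2 := by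
    refine (hone.trans hsum2).trans (le_of_eq ?_)
    rw [mul_pow, mul_pow, Real.sq_sqrt (Nat.cast_nonneg _), Real.sq_sqrt (Finset.sum_nonneg fun r _ => sq_nonneg _)]
    ring
  exact abs_le_of_sq_le_sq hsq (by positivity)

end Lipschitz

/-! ## §4 Toy: two cubes, `φ ≡ ½` -/

section Toy

/- `ι = Fin 2`, `m = Unit`, `φ_s ≡ ½` (`μ₀ = 2`): `Σ_s h_s² = 1`. -/
example : ∑ s : Fin 2, ((fun (_ : Fin 2) (_ : Unit) => (1 / 2 : ℝ)) s () /
    Real.sqrt (∑ r : Fin 2, (fun (_ : Fin 2) (_ : Unit) => (1 / 2 : ℝ)) r () ^ 2)) ^ 2 = 1 :=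
  sum_sq_normalise (fun (_ : Fin 2) (_ : Unit) => (1 / 2 : ℝ)) (fun _ => by simp) (μ₀ := 2)
    (fun _ => by simp) ()

end Toy

end Summit.QuantumFields.BalabanUV.T4Continuum.NE7b.QuadraticPartitionOfUnity

end
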